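import Mathlib
import Summits.Ventures.PercRepro2.Defs
import Summits.Ventures.PercRepro2.Graph
import Summits.Ventures.PercRepro2.OneColourSwitch
import Summits.Ventures.PercRepro2.RegionHubSign
import Summits.Ventures.PercRepro2.SideSwitch
import Summits.Ventures.PercRepro2.SideSwitchM9
import Summits.Ventures.PercRepro2.SideSwitchClosed
import Summits.Ventures.PercRepro2.SideSwitchComps
import Summits.Ventures.PercRepro2.SideSwitchFibre
import Summits.Ventures.PercRepro2.TermSwitchDefs
import Summits.Ventures.PercRepro2.TermSwitchFibre
import Summits.Ventures.PercRepro2.TermSwitchCompsFibre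
import Summits.Ventures.PercRepro2.TermSwitchMono
import Summits.Ventures.PercRepro2.TermSwitchM9
import Summits.Ventures.PercRepro2.TermSwitchReach
import Summits.Ventures.PercRepro2.TermSwitchRestrict
import Summits.Ventures.PercRepro2.M9ReachedSum
import Summits.Ventures.PercRepro2.M9CornerHarris
import Summits.Ventures.PercRepro2.M9OneSidedFibre
import Summits.Ventures.PercRepro2.M9OneSidedFibreM
import Summits.Ventures.PercRepro2.M9OneSidedCorner
import Summits.Ventures.PercRepro2.M9OneSidedTEdge
import Summits.Ventures.PercRepro2.M9OneSidedTEdgeM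

/-!
# The single corners with a `T`-edge (blind cell PercRepro2, p3 g30, 2026-08-28;
`proofs/P3-HDR.md` §12)

With a `Y` `T`-edge and no `W` one (`cK ∧ ¬cM`) the one-sided points of the fibre are the
DOWN-corner `{T : J ∩ T = ∅}` of the joining blocks `J` (`oneSided_assignC_iff_T`); there
`Σ D ≤ 0` (`G` increasing and `T ↦ T ∪ J`), and `Σ σ_rs ≥ 0` (a `W`-connection `r ~ s` of `ρ_T`
runs through switched blocks only and becomes a `Y`-connection after complementing the free
blocks — `conn_rs_compl_down`), so Harris on the sub-cube gives the paired corner sum ≤ 0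
(`down_corner_sum_nonpos`).  The UP-corner (`¬cK ∧ cM`) is the mirror (`up_corner_sum_nonpos`).
Own work; std axioms.
-/
namespace Summit.Ventures.PercRepro2

namespace TermSwitch

open Finset Classical RegionHub OneColourSwitch SideSwitch
variable {V : Type*} {E : Type*}
section TCorner

variable [Fintype V] [DecidableEq V] [Fintype E] [DecidableEq E] {ends : E → Sym2 V} {p q r s d : V}

omit [Fintype E] [DecidableEq E] in
/-- **One-sidedness with `T`-edges**: the down-corner, the up-corner, or the corner pair. -/
theorem oneSided_assignC_iff_T (hT : TEdge ends r s d) {ρ : Config E}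
    (hρ : ∀ x ∈ MH ends ({r, s, d} : Set V) ρ, x ∈ ({r, s, d} : Set V))
    {T : Finset (Finset V)} (hTc : T ⊆ compsH ends ({r, s, d} : Set V) ρ) :
    NoPocket.OneSided ends r s d (assignC ends T ρ) ↔
      (cK ends r s d ρ ∧ ¬ cM ends r s d ρ ∧ joinSetT ends r s d ρ ∩ T = ∅) ∨
      (¬ cK ends r s d ρ ∧ cM ends r s d ρ ∧ joinSetT ends r s d ρ ⊆ T) ∨
      (¬ cK ends r s d ρ ∧ ¬ cM ends r s d ρ ∧ (joinSetT ends r s d ρ).Nonempty ∧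
        (joinSetT ends r s d ρ ∩ T = ∅ ∨ joinSetT ends r s d ρ ⊆ T)) := by
  rw [NoPocket.OneSided, mem_K2_assignC_iff_joinsT hT hρ hTc, mem_M2_assignC_iff_joinsT hT hρ hTc]
  have hK : (∃ B ∈ compsH ends ({r, s, d} : Set V) ρ, B ∉ T ∧ joinsT ends r s d B ρ) ↔
      ¬ joinSetT ends r s d ρ ⊆ T := by
    constructor
    · rintro ⟨B, hB, hBT, hj⟩ hsub
      exact hBT (hsub (Finset.mem_filter.2 ⟨hB, hj⟩))
    · intro h
      rw [Finset.not_subset] at h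
      obtain ⟨B, hB, hBT⟩ := h
      exact ⟨B, (Finset.mem_filter.1 hB).1, hBT, (Finset.mem_filter.1 hB).2⟩
  have hM : (∃ B ∈ T, joinsT ends r s d B ρ) ↔ (joinSetT ends r s d ρ ∩ T).Nonempty := by
    constructor
    · rintro ⟨B, hBT, hj⟩
      exact ⟨B, Finset.mem_inter.2 ⟨Finset.mem_filter.2 ⟨hTc hBT, hj⟩, hBT⟩⟩
    · rintro ⟨B, hB⟩
      obtain ⟨hBJ, hBT⟩ := Finset.mem_inter.1 hB
      exact ⟨B, hBT, (Finset.mem_filter.1 hBJ).2⟩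
  rw [hK, hM]
  have hemp : ∀ {S : Finset (Finset V)}, ¬ S.Nonempty ↔ S = ∅ := fun {S} => Finset.not_nonempty_iff_eq_empty
  constructor
  · rintro ⟨h1, h2⟩
    by_cases hcK : cK ends r s d ρ <;> by_cases hcM : cM ends r s d ρ
    · exact absurd ⟨Or.inl hcK, Or.inl hcM⟩ h2
    · refine Or.inl ⟨hcK, hcM, hemp.1 fun hne => h2 ⟨Or.inl hcK, Or.inr hne⟩⟩
    · refine Or.inr (Or.inl ⟨hcK, hcM, ?_⟩)
      by_contra hsub
      exact h2 ⟨Or.inr hsub, Or.inl hcM⟩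
    · refine Or.inr (Or.inr ⟨hcK, hcM, ?_, ?_⟩)
      · rcases h1 with h | h
        · rcases h with h | h
          · exact absurd h hcK
          · rw [Finset.not_subset] at h
            obtain ⟨B, hB, _⟩ := h
            exact ⟨B, hB⟩
        · rcases h with h | h
          · exact absurd h hcM
          · obtain ⟨B, hB⟩ := h
            exact ⟨B, (Finset.mem_inter.1 hB).1⟩
      · by_cases hsub : joinSetT ends r s d ρ ⊆ T
        · exact Or.inr hsub
        · left
          exact hemp.1 fun hne => h2 ⟨Or.inr hsub, Or.inr hne⟩
  · rintro (⟨hcK, hcM, hint⟩ | ⟨hcK, hcM, hsub⟩ | ⟨hcK, hcM, hne, h⟩)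
    · refine ⟨Or.inl (Or.inl hcK), fun h => ?_⟩
      rcases h.2 with h2 | h2
      · exact hcM h2
      · rw [hint] at h2; exact Finset.not_nonempty_empty h2
    · refine ⟨Or.inr (Or.inl hcM), fun h => ?_⟩
      rcases h.1 with h1 | h1
      · exact hcK h1
      · exact h1 hsub
    · rcases h with h | h
      · have hsub : ¬ joinSetT ends r s d ρ ⊆ T := by
          intro hsub
          obtain ⟨B, hB⟩ := hne
          have : B ∈ joinSetT ends r s d ρ ∩ T := Finset.mem_inter.2 ⟨hB, hsub hB⟩
          rw [h] at this
          exact Finset.notMem_empty B this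
        refine ⟨Or.inl (Or.inr hsub), fun h' => ?_⟩
        rcases h'.2 with h2 | h2
        · exact hcM h2
        · rw [h] at h2; exact Finset.not_nonempty_empty h2
      · have hne' : (joinSetT ends r s d ρ ∩ T).Nonempty := by
          obtain ⟨B, hB⟩ := hne
          exact ⟨B, Finset.mem_inter.2 ⟨hB, h hB⟩⟩
        refine ⟨Or.inr (Or.inr hne'), fun h' => ?_⟩
        rcases h'.1 with h1 | h1
        · exact hcK h1
        · exact h1 h

omit [Fintype V] [Fintype E] [DecidableEq E] in
/-- For `T ⊆ A ∖ J` and `J ⊆ A`: `A ∖ ((A ∖ J) ∖ T) = T ∪ J`. -/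
lemma sdiff_sdiff_sdiff_eq {A J T : Finset (Finset V)} (hJ : J ⊆ A) (hT : T ⊆ A \ J) :
    A \ ((A \ J) \ T) = T ∪ J := by
  ext B
  simp only [Finset.mem_sdiff, Finset.mem_union, not_and, not_not]
  constructor
  · rintro ⟨hBA, h⟩
    by_cases hBJ : B ∈ J
    · exact Or.inr hBJ
    · exact Or.inl (h ⟨hBA, hBJ⟩)
  · rintro (hBT | hBJ)
    · exact ⟨(Finset.mem_sdiff.1 (hT hBT)).1, fun _ => hBT⟩
    · exact ⟨hJ hBJ, fun h => absurd hBJ h.2⟩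

omit [Fintype V] [Fintype E] [DecidableEq E] in
/-- On the down-corner, `Σ G(A ∖ T) ≥ Σ G(T)` for an increasing `G`. -/
lemma sum_sdiff_ge_of_mono {A J : Finset (Finset V)} (hJ : J ⊆ A) (G : Finset (Finset V) → ℤ)
    (hG : ∀ T T', T ⊆ T' → T' ⊆ A → G T ≤ G T') :
    ∑ T ∈ (A \ J).powerset, G T ≤ ∑ T ∈ (A \ J).powerset, G (A \ T) := by
  have h1 : ∑ T ∈ (A \ J).powerset, G (A \ T) = ∑ T ∈ (A \ J).powerset, G (A \ ((A \ J) \ T)) :=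
    (sum_powerset_sdiff (A \ J) (fun T => G (A \ T))).symm
  rw [h1]
  refine Finset.sum_le_sum fun T hT => ?_
  have hT' := Finset.mem_powerset.1 hT
  rw [sdiff_sdiff_sdiff_eq hJ hT']
  exact hG T (T ∪ J) Finset.subset_union_left
    (Finset.union_subset (fun B hB => (Finset.mem_sdiff.1 (hT' hB)).1) hJ)

omit [Fintype E] [DecidableEq E] in
/-- **A `W`-connection `r ~ s` on the down-corner becomes a `Y`-connection after complementing
the free blocks**: it runs through switched blocks only. -/
lemma conn_rs_compl_down (hT : TEdge ends r s d) {ρ : Config E}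
    (hρ : ∀ x ∈ MH ends ({r, s, d} : Set V) ρ, x ∈ ({r, s, d} : Set V))
    (hcM : ¬ cM ends r s d ρ) {T : Finset (Finset V)}
    (hTc : T ⊆ compsH ends ({r, s, d} : Set V) ρ \ joinSetT ends r s d ρ)
    (hc : Conn ends (OneColourSwitch.compl (assignC ends T ρ)) r s) :
    Conn ends (assignC ends ((compsH ends ({r, s, d} : Set V) ρ \ joinSetT ends r s d ρ) \ T) ρ)
      r s := by
  have hTA : T ⊆ compsH ends ({r, s, d} : Set V) ρ := fun B hB => (Finset.mem_sdiff.1 (hTc hB)).1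
  have hT'A : (compsH ends ({r, s, d} : Set V) ρ \ joinSetT ends r s d ρ) \ T ⊆
      compsH ends ({r, s, d} : Set V) ρ :=
    fun B hB => (Finset.mem_sdiff.1 ((Finset.mem_sdiff.1 hB).1)).1
  have hd : d ∈ ({r, s, d} : Set V) := d_mem_triple r s d
  have hr : r ∈ ({r, s, d} : Set V) := r_mem_triple r s d
  have hs : s ∈ ({r, s, d} : Set V) := s_mem_triple r s d
  have hdM : d ∉ M2 ends r s (assignC ends T ρ) := by
    rw [mem_M2_assignC_iff_joinsT hT hρ hTA]
    rintro (h | ⟨B, hBT, hj⟩)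
    · exact hcM h
    · exact (Finset.mem_sdiff.1 (hTc hBT)).2 (Finset.mem_filter.2 ⟨hTA hBT, hj⟩)
  have hW : ∀ {e : E}, OneColourSwitch.compl (assignC ends T ρ) e = true ↔
      assignC ends T ρ e = false := by
    intro e; simp [OneColourSwitch.compl]
  -- the `T'`-switch does not touch the switched blocks of `T`
  have hnotU' : ∀ {x : V}, (∃ B ∈ T, x ∈ B) →
      x ∉ unionT ((compsH ends ({r, s, d} : Set V) ρ \ joinSetT ends r s d ρ) \ T) := by
    rintro x ⟨B, hBT, hxB⟩ hxU
    obtain ⟨B', hB', hxB'⟩ := mem_unionT.1 hxU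
    have := eq_of_mem_compsH_of_mem (hTA hBT) (hT'A hB') hxB hxB'
    exact (Finset.mem_sdiff.1 hB').2 (this ▸ hBT)
  have key : ∀ v, v ∈ {x | Conn ends (assignC ends ((compsH ends ({r, s, d} : Set V) ρ \
      joinSetT ends r s d ρ) \ T) ρ) r x ∧ Conn ends (OneColourSwitch.compl (assignC ends T ρ)) r x ∧
      (x = r ∨ x = s ∨ ∃ B ∈ T, x ∈ B)} → ∀ y,
      (openGraph ends (OneColourSwitch.compl (assignC ends T ρ))).Adj v y →
      y ∈ {x | Conn ends (assignC ends ((compsH ends ({r, s, d} : Set V) ρ \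
        joinSetT ends r s d ρ) \ T) ρ) r x ∧ Conn ends (OneColourSwitch.compl (assignC ends T ρ)) r x ∧
        (x = r ∨ x = s ∨ ∃ B ∈ T, x ∈ B)} := by
    intro v ⟨hv', hvc, hvt⟩ y hvy
    obtain ⟨hne, e, he, hends⟩ := openGraph_adj.1 hvy
    have hyc : Conn ends (OneColourSwitch.compl (assignC ends T ρ)) r y :=
      conn_trans hvc (conn_of_openAdj ⟨e, he, hends⟩)
    rw [hW] at he
    have hvH : v = r ∨ v = s → v ∈ ({r, s, d} : Set V) := by
      rintro (rfl | rfl) <;> simp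
    -- the terminal case, for `v = r` and `v = s` alike
    have hterm : ∀ (hvH' : v ∈ ({r, s, d} : Set V)) (hvd : v ≠ d),
        Conn ends (assignC ends ((compsH ends ({r, s, d} : Set V) ρ \
          joinSetT ends r s d ρ) \ T) ρ) r y ∧ (y = r ∨ y = s ∨ ∃ B ∈ T, y ∈ B) := by
      intro hvH' hvd
      by_cases hyH : y ∈ ({r, s, d} : Set V)
      · -- the only edge between terminals is `d–r`; it is `W`: excluded by `¬cM`
        exfalso
        have hdr : ends e = s(d, r) := terminal_edge_cases hT hends hne hvH' hyH
        have hρe : ρ e = false := by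
          rw [← assignC_eq_of_notMem (T := T) (ρ := ρ) hends (term_notMem_unionT hTA hvH')
            (term_notMem_unionT hTA hyH)]
          exact he
        exact hcM ⟨e, Or.inl hdr, hρe⟩
      by_cases hyS : y ∈ KH ends ({r, s, d} : Set V) ρ ∪ MH ends ({r, s, d} : Set V) ρ
      · have hyA : y ∈ A0H ends ({r, s, d} : Set V) ρ := mem_A0H.2 ⟨hyS, hyH⟩
        obtain ⟨B, hB, hyB⟩ := exists_block_of_mem_A0H hyA
        have hρe : ρ e = true := edge_term_sided_true hρ hends hvH' hyH
        have hBT : B ∈ T := by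
          by_contra hBT
          have hyU : y ∉ unionT T := notMem_unionT_of_mem_of_notMem hTA hB hBT hyB
          rw [assignC_eq_of_notMem hends (term_notMem_unionT hTA hvH') hyU, hρe] at he
          exact absurd he (by decide)
        refine ⟨?_, Or.inr (Or.inr ⟨B, hBT, hyB⟩)⟩
        have he' : assignC ends ((compsH ends ({r, s, d} : Set V) ρ \ joinSetT ends r s d ρ) \ T) ρ
            e = true := by
          rw [assignC_eq_of_notMem hends (term_notMem_unionT hT'A hvH') (hnotU' ⟨B, hBT, hyB⟩)]
          exact hρe
        exact conn_trans hv' (conn_of_openAdj ⟨e, he', hends⟩)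
      · -- an outside vertex `W`-adjacent to a terminal lies in `MH`: excluded
        exfalso
        have hvU : v ∉ unionT T := term_notMem_unionT hTA hvH'
        have hyU : y ∉ unionT T := out_notMem_unionT hTA hyS
        rw [assignC_eq_of_notMem hends hvU hyU] at he
        apply hyS
        exact Or.inr (mem_MH_iff.2 ⟨v, hvH', conn_of_openAdj ⟨e, by simp [OneColourSwitch.compl, he],
          hends⟩⟩)
    rcases hvt with hvr | hvs | ⟨B, hBT, hvB⟩
    · obtain ⟨h1, h2⟩ := hterm (hvH (Or.inl hvr)) (hvr ▸ hT.rd)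
      exact ⟨h1, hyc, h2⟩
    · obtain ⟨h1, h2⟩ := hterm (hvH (Or.inr hvs)) (hvs ▸ hT.sd)
      exact ⟨h1, hyc, h2⟩
    · -- from a vertex of a switched block `B`
      have hvA : v ∈ A0H ends ({r, s, d} : Set V) ρ := subset_A0H_of_mem_compsH (hTA hBT) hvB
      have hvU : v ∈ unionT T := mem_unionT.2 ⟨B, hBT, hvB⟩
      have hvU' : v ∉ unionT ((compsH ends ({r, s, d} : Set V) ρ \ joinSetT ends r s d ρ) \ T) :=
        hnotU' ⟨B, hBT, hvB⟩
      rw [assignC_eq_not_of_mem hends (Or.inl hvU)] at he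
      have hρe : ρ e = true := by
        rcases h : ρ e with _ | _
        · rw [h] at he; exact absurd he (by decide)
        · rfl
      by_cases hyH : y ∈ ({r, s, d} : Set V)
      · by_cases hyd : y = d
        · exfalso
          apply hdM
          rw [hyd] at hyc
          rcases mem_M2_iff.1 (mem_M2_iff.2 (Or.inl hyc)) with h | h
          · exact mem_M2_iff.2 (Or.inl h)
          · exact mem_M2_iff.2 (Or.inr h)
        have hyrs : y = r ∨ y = s := by
          simp only [Set.mem_insert_iff, Set.mem_singleton_iff] at hyH
          rcases hyH with h | h | h
          · exact Or.inl h
          · exact Or.inr h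
          · exact absurd h hyd
        have he' : assignC ends ((compsH ends ({r, s, d} : Set V) ρ \ joinSetT ends r s d ρ) \ T) ρ
            e = true := by
          rw [assignC_eq_of_notMem hends hvU' (term_notMem_unionT hT'A hyH)]; exact hρe
        refine ⟨conn_trans hv' (conn_of_openAdj ⟨e, he', hends⟩), hyc, ?_⟩
        rcases hyrs with h | h
        · exact Or.inl h
        · exact Or.inr (Or.inl h)
      by_cases hyS : y ∈ KH ends ({r, s, d} : Set V) ρ ∪ MH ends ({r, s, d} : Set V) ρ
      · have hyA : y ∈ A0H ends ({r, s, d} : Set V) ρ := mem_A0H.2 ⟨hyS, hyH⟩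
        have hyB : y ∈ B := mem_of_adj_of_mem_compsH (hTA hBT) hends hvB hyA
        have he' : assignC ends ((compsH ends ({r, s, d} : Set V) ρ \ joinSetT ends r s d ρ) \ T) ρ
            e = true := by
          rw [assignC_eq_of_notMem hends hvU' (hnotU' ⟨B, hBT, hyB⟩)]; exact hρe
        exact ⟨conn_trans hv' (conn_of_openAdj ⟨e, he', hends⟩), hyc, Or.inr (Or.inr ⟨B, hBT, hyB⟩)⟩
      · -- a `Y`-edge from a sided vertex to an outside vertex: impossible
        exfalso
        have := edge_KH_out_false hends (mem_KH_of_mem_A0H hρ hvA) (fun h => hyS (Or.inl h))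
        rw [hρe] at this; exact absurd this (by decide)
  obtain ⟨h1, _, _⟩ := mem_of_conn_of_closed key ⟨conn_refl _ _ _, conn_refl _ _ _, Or.inl rfl⟩ hc
  exact h1

omit [DecidableEq E] in
/-- **`Σ σ_rs ≥ 0` on the down-corner**: pairing `T` with its complement among the free blocks. -/
lemma down_corner_S_nonneg (hT : TEdge ends r s d) {ρ : Config E}
    (hρ : ∀ x ∈ MH ends ({r, s, d} : Set V) ρ, x ∈ ({r, s, d} : Set V))
    (hcM : ¬ cM ends r s d ρ) :
    0 ≤ ∑ T ∈ (compsH ends ({r, s, d} : Set V) ρ \ joinSetT ends r s d ρ).powerset,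
      sigma ends (assignC ends T ρ) r s := by
  set A' := compsH ends ({r, s, d} : Set V) ρ \ joinSetT ends r s d ρ with hA'
  -- the pointwise bound `S(T) + S(A' ∖ T) ≥ 0`
  have hpt : ∀ T ∈ A'.powerset, 0 ≤ sigma ends (assignC ends T ρ) r s +
      sigma ends (assignC ends (A' \ T) ρ) r s := by
    intro T hT'
    have hTc : T ⊆ A' := Finset.mem_powerset.1 hT'
    have hTc' : A' \ T ⊆ A' := Finset.sdiff_subset
    have h1 : Conn ends (OneColourSwitch.compl (assignC ends T ρ)) r s →
        Conn ends (assignC ends (A' \ T) ρ) r s := conn_rs_compl_down hT hρ hcM hTc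
    have h2 : Conn ends (OneColourSwitch.compl (assignC ends (A' \ T) ρ)) r s →
        Conn ends (assignC ends T ρ) r s := by
      intro h
      have := conn_rs_compl_down hT hρ hcM hTc' h
      rwa [Finset.sdiff_sdiff_eq_self hTc] at this
    unfold sigma
    split_ifs with ha hc hb hd <;>
      first
      | exact absurd (h1 (by assumption)) (by assumption)
      | exact absurd (h2 (by assumption)) (by assumption)
      | norm_num
  have hsum : ∑ T ∈ A'.powerset, (sigma ends (assignC ends T ρ) r s +
      sigma ends (assignC ends (A' \ T) ρ) r s) =
      2 * ∑ T ∈ A'.powerset, sigma ends (assignC ends T ρ) r s := by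
    rw [Finset.sum_add_distrib, sum_powerset_sdiff A' (fun T => sigma ends (assignC ends T ρ) r s)]
    ring
  have := Finset.sum_nonneg hpt
  linarith

/-- **The paired fibre sum over the down-corner is non-positive.** -/
theorem down_corner_sum_nonpos (hT : TEdge ends r s d) {ρ : Config E}
    (hρ : ρ ∈ RepH ends p q ({r, s, d} : Set V)) (hcM : ¬ cM ends r s d ρ) :
    ∑ T ∈ (compsH ends ({r, s, d} : Set V) ρ \ joinSetT ends r s d ρ).powerset,
      (sigma ends (assignC ends T ρ) p q +
        sigma ends (assignC ends T (flipOH ends ({r, s, d} : Set V) ρ)) p q) *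
        sigma ends (assignC ends T ρ) r s ≤ 0 := by
  have hρM : ∀ x ∈ MH ends ({r, s, d} : Set V) ρ, x ∈ ({r, s, d} : Set V) := (mem_RepH.1 hρ).2
  have hr : r ∈ ({r, s, d} : Set V) := r_mem_triple r s d
  set A := compsH ends ({r, s, d} : Set V) ρ with hA
  set J := joinSetT ends r s d ρ with hJ
  have hJA : J ⊆ A := Finset.filter_subset _ _
  let Yc : Finset (Finset V) → ℤ := fun T => if Conn ends (assignC ends T ρ) p q then 1 else 0
  let Yc' : Finset (Finset V) → ℤ := fun T =>
    if Conn ends (assignC ends T (flipOH ends ({r, s, d} : Set V) ρ)) p q then 1 else 0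
  let G : Finset (Finset V) → ℤ := fun T => Yc T + Yc' T
  let D : Finset (Finset V) → ℤ := fun T => G T - G (A \ T)
  let S : Finset (Finset V) → ℤ := fun T => sigma ends (assignC ends T ρ) r s
  have hρO := flipOH_mem_RepH hρ
  have hmonoYc : ∀ T T', T ⊆ T' → T' ⊆ A → Yc T ≤ Yc T' := by
    intro T T' hTT hT'
    exact ite_le_ite_of_imp (conn_pq_assignC_mono_H hρ hTT hT')
  have hmonoYc' : ∀ T T', T ⊆ T' → T' ⊆ A → Yc' T ≤ Yc' T' := by
    intro T T' hTT hT'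
    have hT'O : T' ⊆ compsH ends ({r, s, d} : Set V) (flipOH ends ({r, s, d} : Set V) ρ) := by
      rw [compsH_flipOH]; exact hT'
    exact ite_le_ite_of_imp (conn_pq_assignC_mono_H hρO hTT hT'O)
  have hmonoG : ∀ T T', T ⊆ T' → T' ⊆ A → G T ≤ G T' := by
    intro T T' hTT hT'
    have := hmonoYc T T' hTT hT'; have := hmonoYc' T T' hTT hT'
    simp only [G]; linarith
  have hmonoD : ∀ T T', T ⊆ T' → T' ⊆ A → D T ≤ D T' := by
    intro T T' hTT hT'
    have h1 := hmonoG T T' hTT hT'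
    have h2 := hmonoG (A \ T') (A \ T) (Finset.sdiff_subset_sdiff (Finset.Subset.refl A) hTT)
      Finset.sdiff_subset
    simp only [D]; linarith
  have hantiS : ∀ T T', T ⊆ T' → T' ⊆ A → S T' ≤ S T := by
    intro T T' hTT hT'
    show sigma ends (assignC ends T' ρ) r s ≤ sigma ends (assignC ends T ρ) r s
    unfold sigma
    exact sub_le_sub (ite_le_ite_of_imp (conn_rs_assignC_anti_H hρ hr s hTT hT'))
      (ite_le_ite_of_imp (conn_rs_compl_assignC_mono_H hρ hr s hTT hT'))
  have hsubA : ∀ T, T ⊆ A \ J → T ⊆ A := fun T hT' B hB => (Finset.mem_sdiff.1 (hT' hB)).1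
  -- `Σ D ≤ 0` on the down-corner
  have hD0 : ∑ T ∈ (A \ J).powerset, D T ≤ 0 := by
    simp only [D]
    rw [Finset.sum_sub_distrib]
    have := sum_sdiff_ge_of_mono hJA G hmonoG
    linarith
  -- `Σ S ≥ 0` on the down-corner
  have hS0 : 0 ≤ ∑ T ∈ (A \ J).powerset, S T := down_corner_S_nonneg hT hρM hcM
  -- Harris on the sub-cube
  have hH := harris_powerset (A \ J) D (fun T => - S T)
    (fun T T' h1 h2 => hmonoD T T' h1 (hsubA T' h2))
    (fun T T' h1 h2 => by have := hantiS T T' h1 (hsubA T' h2); linarith)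
  simp only [Finset.sum_neg_distrib, mul_neg] at hH
  have hN : (0 : ℤ) < 2 ^ (A \ J).card := pow_pos two_pos _
  have hprod : (∑ T ∈ (A \ J).powerset, D T) * (∑ T ∈ (A \ J).powerset, S T) ≤ 0 :=
    mul_nonpos_of_nonpos_of_nonneg hD0 hS0
  have hDS : ∑ T ∈ (A \ J).powerset, D T * S T ≤ 0 := by
    by_contra hcon
    have hpos : 0 < ∑ T ∈ (A \ J).powerset, D T * S T := lt_of_not_ge hcon
    have := mul_pos hN hpos
    nlinarith
  refine le_trans (le_of_eq ?_) hDS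
  refine Finset.sum_congr rfl (fun T hT' => ?_)
  rw [sigma_pq_add_flipOH_C hρ (hsubA T (Finset.mem_powerset.1 hT'))]

end TCorner
end TermSwitch
end Summit.Ventures.PercRepro2
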